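import Literature.NumberTheory.Automorphic.LevelActionCohomologyFinite
import Literature.NumberTheory.Automorphic.HidaIndependenceOfWeightOrdinary
import HarnessLib

/-!
# Finiteness on the Hida tower of `GL₂` given Borel–Serre, and independence of weight
# without finiteness hypotheses

Topic `NumberTheory/Automorphic`; namespaces `Literature.NumberTheory.Automorphic.BigHeckeGLn` and
`….BigHeckeGLn.TameLevel`; theorems only.  Consequences of the Borel–Serre named fact
`BorelSerre1973_finite_groupCohomology_congruenceSubgroup` (`X` below) for the Hida tower of `GL₂`
over a number field ([Hida1994AIF, §2]; [KhareThorne2017, §6.3–6.4]):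

* `BigHeckeGLn.finite_cohomology_two_of_borelSerre'` — `H^i(X_U, M)` (`ArithmeticQuotient` model)
  is finite for `M` a finite module over ANY coefficient ring `S` (the tree's
  `finite_cohomology_two_of_borelSerre` is the case `S = ℤ`; the reduction to it is the
  independence of group cohomology from the scalars, `finite_groupCohomology_iff_intRep`);
* `TameLevel.finite_symPowCohomology_level_of_borelSerre` — `H^i(U(b,c), Sym^m(S²))`
  (coefficients at `p`, `S` finite) is finite (`LevelActionCohomologyFinite`);
* `TameLevel.independenceOfWeight_bijOn_level_ordinaryPart_of_borelSerre` — hence the tree's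
  **independence of weight onto the ordinary part**
  (`HidaIndependenceOfWeightOrdinary.independenceOfWeight_bijOn_level_ordinaryPart`,
  [KhareThorne2017, Prop. 6.13]) holds WITHOUT its two `[Finite]` hypotheses, given `X`, for
  `Γ = GL₂(K)` and a finite coefficient ring `S` (e.g. `𝒪_v / ϖ_v^r`).

## References

* A. Borel, J.-P. Serre, *Corners and arithmetic groups*, Comment. Math. Helv. 48 (1973), §11.1.
  [BorelSerre1973]
* C. Khare, J. A. Thorne, Amer. J. Math. 139 (2017), §6.4, Prop. 6.13 (arXiv:1409.7007, held).
  [KhareThorne2017]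
* H. Hida, Ann. Inst. Fourier 44 (1994), §2, Prop. 2.1 (held). [Hida1994AIF]
-/

noncomputable section

open CategoryTheory IsDedekindDomain NumberField
open scoped NumberField

namespace Literature.NumberTheory.Automorphic

open Literature.Algebra.Homology

namespace BigHeckeGLn

/-- **`H^i(X_U, M)` is finite for `GL₂` over a number field, `U` compact open and `M` a finite
module over any coefficient ring**, GIVEN `BorelSerre1973_finite_groupCohomology_congruenceSubgroup`.
[cite: BorelSerre1973, §11.1] -/
theorem finite_cohomology_two_of_borelSerre'
    (h : BorelSerre1973_finite_groupCohomology_congruenceSubgroup)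
    (K : Type) [Field K] [NumberField K] (U : Subgroup (FiniteAdelicGL 2 K))
    (hU : IsOpen (U : Set (FiniteAdelicGL 2 K))) (hUc : IsCompact (U : Set (FiniteAdelicGL 2 K)))
    {S : Type} [CommRing S] (M : Type) [AddCommGroup M] [Module S M] [Finite M] (i : ℕ) :
    Finite (ArithmeticQuotient.cohomology S (globalEmbedding 2 K) U M i) := by
  rw [ArithmeticQuotient.finite_cohomology_iff_twisted]
  obtain ⟨s₀, hcov⟩ := exists_finset_orbit_cover_two K U hU
  refine TwistedQuotient.finite_cohomology_of_finite_cover (globalEmbedding 2 K) U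
    (1 : Representation S (GL (Fin 2) K) M) s₀ hcov i fun x _ => ?_
  rw [finite_groupCohomology_iff_intRep]
  haveI : Finite (intRep (TwistedQuotient.stabilizerRep (globalEmbedding 2 K) U
      (1 : Representation S (GL (Fin 2) K) M) x)) := ‹Finite M›
  exact h 2 K (MulAction.stabilizer (FiniteAdelicGL 2 K) x)
    (TwistedQuotient.isOpen_stabilizer_coe U hU x) (TwistedQuotient.isCompact_stabilizer_coe U hUc x)
    _ this i

namespace TameLevel

open LevelAction IntegralWeightGL2

variable {K : Type} [Field K] [NumberField K] {p : ℕ} [Fact p.Prime] (𝒰 : TameLevel 2 K p)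
  {v : HeightOneSpectrum (𝓞 K)} (hv : (p : 𝓞 K) ∈ v.asIdeal) {S : Type} [CommRing S]
  (red : v.adicCompletionIntegers K →+* S) {b c : ℕ} (hbc : b ≤ c)
  (hred : ∀ x : v.adicCompletionIntegers K,
    Valued.v (x : v.adicCompletion K) ≤ (WithZero.exp (-(b : ℤ)) : WithZero (Multiplicative ℤ)) →
      red x = 0)
  (m r i : ℕ)

omit [Fact p.Prime] in
/-- `Sym^m(S²)` is finite for a finite coefficient ring `S`. [folklore] -/
theorem finite_symPow [Finite S] (m : ℕ) : Finite (SymPow S m) := by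
  haveI : Module.Finite S (SymPow S m) :=
    Module.Finite.iff_fg.mpr (MvPolynomial.homogeneousSubmodule_fg (Fin 2) S m)
  exact Module.finite_of_finite S

include hv hbc hred in
/-- **`H^i(U(b,c), Sym^m(S²))` (coefficients at `p`) is finite** for `S` finite, GIVEN
`BorelSerre1973_finite_groupCohomology_congruenceSubgroup`. [cite: BorelSerre1973, §11.1]
[cite: KhareThorne2017, §6.4] -/
theorem finite_symPowCohomology_level_of_borelSerre [Finite S]
    (h : BorelSerre1973_finite_groupCohomology_congruenceSubgroup) :
    Finite (cohomology (globalEmbedding 2 K) (iwahoriMonoid K v red) (symPowCoeff K v red m)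
      (𝒰.level b c) i) := by
  haveI := finite_symPow (S := S) m
  exact 𝒰.finite_levelActionCohomology_level_of_borelSerre h K p b c (iwahoriMonoid K v red)
    (𝒰.level_le_iwahoriMonoid' hv red hbc hred) (symPowCoeff K v red m) i

/-- **Independence of weight onto the `U_{v,1}`-ordinary part of the Hida tower, without finiteness
hypotheses** (GIVEN `BorelSerre1973_finite_groupCohomology_congruenceSubgroup`): for `U` maximal
above `p`, `b ≤ c`, `1 ≤ r ≤ c`, a finite coefficient ring `S` and `red : 𝒪_v → S` killing the closed
ball of radius `|ϖ_v|^b` with `red(ϖ_v)^r = 0`, the composite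
`H^i(U(b,c), Sym^m(S²)) →(λ₁)_*→ H^i(U(b,c), S(χ_m)) ≅ H^i(X_{U(b,c)}, S)` is a bijection from the
`[U t_{v,1}^r U]`-ordinary part onto the `U_{v,1}`-ordinary part (the tree's
`independenceOfWeight_bijOn_level_ordinaryPart` for `Γ = GL₂(K)`, its `[Finite]` hypotheses
discharged by `finite_symPowCohomology_level_of_borelSerre` and `finite_cohomology_two_of_borelSerre'`).
[cite: KhareThorne2017, §6.4, Prop. 6.13] [cite: Hida1994AIF, §2, Prop. 2.1] -/
theorem independenceOfWeight_bijOn_level_ordinaryPart_of_borelSerre [Finite S]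
    (h : BorelSerre1973_finite_groupCohomology_congruenceSubgroup) (h𝒰 : 𝒰.IsMaximalAbove)
    (hr1 : 1 ≤ r) (hrc : r ≤ c) (hr : red ⟨_, uniformizerAt_mem_adicCompletionIntegers K v⟩ ^ r = 0) :
    Set.BijOn
      ((cohomologyIso (globalEmbedding 2 K) (iwahoriMonoid K v red) (lowChar K v red m) (𝒰.level b c)
          (𝒰.level_le_iwahoriMonoid' hv red hbc hred) (𝒰.lowChar_eq_one_of_mem_level hv red hbc hred m) i).hom.hom ∘
        (pushforwardCohomology (globalEmbedding 2 K) (iwahoriMonoid K v red) (symPowCoeff K v red m)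
          (lowChar K v red m) (𝒰.level b c) (coeffX₁ S m) (coeffX₁_comp_symPowCoeff m) i).hom)
      (⨅ n : ℕ, LinearMap.range (heckeCohomology (globalEmbedding 2 K) (iwahoriMonoid K v red)
        (symPowCoeff K v red m) (𝒰.level b c) (𝒰.level_le_iwahoriMonoid' hv red hbc hred)
        (heckeElement_pow_mem_iwahoriMonoid K v red r) i ^ n) : Submodule S _)
      (⨅ n : ℕ, LinearMap.range
        (ArithmeticQuotient.heckeEnd S (𝒰.level b c) (heckeElement 2 K v 1) S (globalEmbedding 2 K) i ^ n) :
          Submodule S _) := by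
  haveI := 𝒰.finite_symPowCohomology_level_of_borelSerre hv red hbc hred m i h
  haveI : Finite (ArithmeticQuotient.cohomology S (globalEmbedding 2 K) (𝒰.level b c) S i) :=
    finite_cohomology_two_of_borelSerre' h K (𝒰.level b c) (𝒰.isOpen_level b c)
      (𝒰.isCompact_level b c) S i
  exact 𝒰.independenceOfWeight_bijOn_level_ordinaryPart hv red hbc hred (globalEmbedding 2 K) m r i
    h𝒰 hr1 hrc hr

end TameLevel

end BigHeckeGLn

end Literature.NumberTheory.Automorphic
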